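import Summits.HubbardSuperconductivity.HubbardSuperconductivity.Theorems.AnisotropyChordTowerEdgeSectors
import Summits.HubbardSuperconductivity.HubbardSuperconductivity.Theorems.AnisotropyChordTowerShapeConstant

/-!
# Route `AnisotropyChord` / H0 rotor rung: **RUNG XY-LM_FM PROVED** — `totalSpinMonotoneNearFM_holds : TotalSpinMonotoneNearFM`
# (work-order v13(e) of theory seat `hubbard-h0-rotor-theory-1`, memo ROTOR-THEORY-11 §154/§160/§161; director CYCLE-12 ruling (A):
# «LAND TotalSpinMonotoneNearFM = RUNG XY-LM_FM, a new-combination theorem»)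

On every torus `(ℤ/L)²` there is `η₀ > 0` such that for `1 − η₀ < Δ ≤ 1` the Perron sector ground amplitudes of the
spin-½ XXZ / hard-core boson Hamiltonian `H(Δ)` are ordered ferromagnetically in total spin:
`|M| ≤ |M'| ⇒ ⟨S⃗²⟩_{ψ_M} ≤ ⟨S⃗²⟩_{ψ_{M'}}` — the XY-side analogue of Lieb–Mattis ordering near the ferromagnetic point.

Assembly: `totalSpinSq = S(S+1) − 2⟨a, B a⟩` (`…TowerDeficit`); extreme sectors have `⟨a, B a⟩ = 0` (`…TowerEdgeSectors`);
`|M| = |M'|` by uniqueness / particle–hole conjugation (`…TowerBridge`, `…TowerParticleHole`); `|M| < |M'|` in the bulk by the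
second-order envelope `⟨ψ, Bψ⟩ = η²(2S−1)·cg(n)·‖v‖²/P₄ + o(η²)` uniformly in the state (`…TowerSecondOrder`, `…TowerShapeConstant`)
and the integrality + strict monotonicity of the Clebsch–Gordan shape `cg(n) = n(n−1)(|V|−n)(|V|−n−1)` (`cgShape_strictAnti`).
-/

set_option linter.dupNamespace false
set_option autoImplicit false

noncomputable section

open Finset Matrix
open Summit.HubbardSuperconductivity.HubbardSuperconductivity.Theorems.AnisotropyChord.InsertionEntropy
open Literature.MathematicalPhysics.QuantumLattice Literature.Probability.LatticeModels

namespace Summit.HubbardSuperconductivity.HubbardSuperconductivity.Theorems.AnisotropyChord.Tower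

/-! ### Real-arithmetic core of the bulk comparison -/

/-- The pair inequality: two deficits with leading coefficients `cg ≥ cg' + 1` and uniform envelopes are ordered for small `η`.
[folklore] -/
theorem pair_ineq (η lamP cg cg' C₄ C₄' C₅ C₅' G D D' : ℝ)
    (hη0 : 0 ≤ η) (hη1 : η ≤ 1) (hlamP : 0 < lamP) (hcg' : 0 ≤ cg') (hgap : cg' + 1 ≤ cg)
    (hG : cg + cg' ≤ 2 * G) (hG0 : 0 < G) (hC₄ : 0 ≤ C₄) (hC₄' : 0 ≤ C₄')
    (hD : |D - η ^ 2 * (lamP * cg)|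
      ≤ (1 / (4 * G) + C₄ * η ^ 2) * (η ^ 2 * (lamP * cg)) + (1 + (1 / (4 * G))⁻¹) * C₅ * η ^ 3)
    (hD' : |D' - η ^ 2 * (lamP * cg')|
      ≤ (1 / (4 * G) + C₄' * η ^ 2) * (η ^ 2 * (lamP * cg')) + (1 + (1 / (4 * G))⁻¹) * C₅' * η ^ 3)
    (hsmall : η * (2 * lamP * G * (C₄ + C₄') + (1 + 4 * G) * (C₅ + C₅')) ≤ lamP / 2) :
    D' ≤ D := by
  have hs : (1 / (4 * G))⁻¹ = 4 * G := by rw [one_div, inv_inv]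
  rw [hs] at hD hD'
  have hDl := (abs_le.1 hD).1
  have hDu := (abs_le.1 hD').2
  have hX0 : 0 ≤ η ^ 2 * lamP := mul_nonneg (sq_nonneg _) hlamP.le
  have hcg2 : cg ≤ 2 * G := by linarith
  have hcg'2 : cg' ≤ 2 * G := by linarith
  have hcg0 : 0 ≤ cg := by linarith
  -- (a) the leading gap
  have ha : η ^ 2 * lamP ≤ η ^ 2 * lamP * (cg - cg') := by nlinarith
  -- (b) the `s(cg + cg')` term
  have hb : 1 / (4 * G) * (η ^ 2 * lamP) * (cg + cg') ≤ η ^ 2 * lamP / 2 := by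
    have h1 : (cg + cg') / (4 * G) ≤ 1 / 2 := by
      rw [div_le_iff₀ (by positivity)]; linarith
    calc 1 / (4 * G) * (η ^ 2 * lamP) * (cg + cg') = (η ^ 2 * lamP) * ((cg + cg') / (4 * G)) := by ring
      _ ≤ (η ^ 2 * lamP) * (1 / 2) := mul_le_mul_of_nonneg_left h1 hX0
      _ = η ^ 2 * lamP / 2 := by ring
  -- (c) the quartic terms
  have hc : η ^ 2 * (η ^ 2 * lamP) * (C₄ * cg + C₄' * cg') ≤ η * (η ^ 2 * lamP) * (2 * G * (C₄ + C₄')) := by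
    have h1 : C₄ * cg + C₄' * cg' ≤ 2 * G * (C₄ + C₄') := by nlinarith
    have h2 : η ^ 2 ≤ η := by nlinarith
    calc η ^ 2 * (η ^ 2 * lamP) * (C₄ * cg + C₄' * cg')
        ≤ η ^ 2 * (η ^ 2 * lamP) * (2 * G * (C₄ + C₄')) :=
          mul_le_mul_of_nonneg_left h1 (mul_nonneg (sq_nonneg _) hX0)
      _ ≤ η * (η ^ 2 * lamP) * (2 * G * (C₄ + C₄')) := by
          apply mul_le_mul_of_nonneg_right (mul_le_mul_of_nonneg_right h2 hX0)
          positivity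
  -- (e) the smallness, multiplied by `η²`
  have he : η ^ 2 * (η * (2 * lamP * G * (C₄ + C₄') + (1 + 4 * G) * (C₅ + C₅'))) ≤ η ^ 2 * (lamP / 2) :=
    mul_le_mul_of_nonneg_left hsmall (sq_nonneg _)
  nlinarith [hDl, hDu, ha, hb, hc, he]

/-! ### Book-keeping on the torus -/

section Torus

variable {L : ℕ} [NeZero L]

/-- The sector of a Perron amplitude has a natural particle number `n ≤ |V|` with `n = |V|/2 + M`. [folklore] -/
theorem perron_natSector {Δ M : ℝ} {a : TensorIndex (TorusSite 2 L) 2 → ℝ} (ha : IsPerronSectorGroundAmplitude L Δ M a) :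
    ∃ n : ℕ, n ≤ Fintype.card (TorusSite 2 L) ∧ (n : ℝ) = (Fintype.card (TorusSite 2 L) : ℝ) / 2 + M := by
  obtain ⟨σ₀, hσ₀⟩ : ∃ σ₀, a σ₀ ≠ 0 := by
    by_contra h; push Not at h
    have : ∑ σ, a σ ^ 2 = 0 := Finset.sum_eq_zero fun σ _ => by rw [h σ]; ring
    rw [ha.unit] at this; exact one_ne_zero this
  refine ⟨(zeroSet σ₀).card, ?_, ?_⟩
  · exact (Finset.card_le_univ _).trans_eq (Finset.card_univ)
  · rw [← zerosCard_eq_card, perron_support ha σ₀ hσ₀]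

/-- `totalSpinSq a M = S(S+1) − 2⟨a, B a⟩` for a Perron amplitude, `S = |V|/2`. [folklore] -/
theorem perron_totalSpinSq {Δ M : ℝ} {a : TensorIndex (TorusSite 2 L) 2 → ℝ} (ha : IsPerronSectorGroundAmplitude L Δ M a) :
    totalSpinSq a M = ((Fintype.card (TorusSite 2 L) : ℝ) / 2) * ((Fintype.card (TorusSite 2 L) : ℝ) / 2 + 1)
      - 2 * ∑ σ, a σ * fmOp (⊤ : SimpleGraph (TorusSite 2 L)) a σ := by
  obtain ⟨n, -, hn⟩ := perron_natSector ha
  exact totalSpinSq_eq_sub_two_inner_fmOp_top a _ M n (by ring) (by rw [hn]) (fun ν hν => by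
    rw [perron_support ha ν hν, hn]) ha.unit

/-- Reduction: the rung's inequality is the reverse inequality of the complete-graph forms. [folklore] -/
theorem totalSpinSq_le_of_inner_top_le {Δ M M' : ℝ} {a a' : TensorIndex (TorusSite 2 L) 2 → ℝ}
    (ha : IsPerronSectorGroundAmplitude L Δ M a) (ha' : IsPerronSectorGroundAmplitude L Δ M' a')
    (h : ∑ σ, a' σ * fmOp (⊤ : SimpleGraph (TorusSite 2 L)) a' σ ≤ ∑ σ, a σ * fmOp (⊤ : SimpleGraph (TorusSite 2 L)) a σ) :
    totalSpinSq a M ≤ totalSpinSq a' M' := by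
  rw [perron_totalSpinSq ha, perron_totalSpinSq ha']; linarith

/-- Extreme sectors are maximal: if `n' ≤ 1` or `n' ≥ |V| − 1` then `⟨a', B a'⟩ ≤ ⟨a, B a⟩`. [folklore] -/
theorem inner_top_le_of_edge {Δ M' : ℝ} {a' : TensorIndex (TorusSite 2 L) 2 → ℝ}
    (ha' : IsPerronSectorGroundAmplitude L Δ M' a') (n' : ℕ) (hn'le : n' ≤ Fintype.card (TorusSite 2 L))
    (hn' : (n' : ℝ) = (Fintype.card (TorusSite 2 L) : ℝ) / 2 + M')
    (hedge : n' ≤ 1 ∨ Fintype.card (TorusSite 2 L) - 1 ≤ n') (a : TensorIndex (TorusSite 2 L) 2 → ℝ) :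
    ∑ σ, a' σ * fmOp (⊤ : SimpleGraph (TorusSite 2 L)) a' σ ≤ ∑ σ, a σ * fmOp (⊤ : SimpleGraph (TorusSite 2 L)) a σ := by
  have hreg := torus_degree_const (L := L)
  have h0 : ∑ σ, a' σ * fmOp (⊤ : SimpleGraph (TorusSite 2 L)) a' σ = 0 := by
    refine perron_inner_top_eq_zero_of_edge ha' _ hreg ?_
    rw [← hn']
    rcases hedge with h | h
    · rcases Nat.le_one_iff_eq_zero_or_eq_one.1 h with h1 | h1
      · left; rw [h1]; simp
      · right; left; rw [h1]; simp
    · rcases Nat.eq_or_lt_of_le hn'le with h1 | h1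
      · right; right; right; rw [h1]
      · right; right; left
        have : n' = Fintype.card (TorusSite 2 L) - 1 := by omega
        rw [this, Nat.cast_sub (by omega)]; simp
  rw [h0]; exact inner_fmOp_nonneg ⊤ a

/-- The Clebsch–Gordan shape on a natural sector is the natural number `n(|V|−n)(n−1)(|V|−n−1)`. [folklore] -/
theorem cgShape_natCast (Nv n : ℕ) (h1 : 1 ≤ n) (h2 : n + 1 ≤ Nv) (M : ℝ) (hn : (n : ℝ) = (Nv : ℝ) / 2 + M) :
    cgShape ((Nv : ℝ) / 2) M = ((n * (Nv - n) * (n - 1) * (Nv - n - 1) : ℕ) : ℝ) := by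
  have hM : M = (n : ℝ) - (Nv : ℝ) / 2 := by linarith
  rw [hM]
  unfold cgShape
  rw [Nat.cast_mul, Nat.cast_mul, Nat.cast_mul, Nat.cast_sub (by omega), Nat.cast_sub h1,
    Nat.cast_sub (by omega), Nat.cast_sub (by omega)]
  push_cast; ring

/-- The natural CG shape is at most `|V|⁴`. [folklore] -/
theorem cgNat_le (Nv n : ℕ) : n * (Nv - n) * (n - 1) * (Nv - n - 1) ≤ Nv ^ 4 ∨ Nv < n := by
  by_cases h : n ≤ Nv
  · left
    have h1 : n ≤ Nv := h
    have h2 : Nv - n ≤ Nv := Nat.sub_le _ _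
    have h3 : n - 1 ≤ Nv := by omega
    have h4 : Nv - n - 1 ≤ Nv := by omega
    calc n * (Nv - n) * (n - 1) * (Nv - n - 1) ≤ Nv * Nv * Nv * Nv :=
          Nat.mul_le_mul (Nat.mul_le_mul (Nat.mul_le_mul h1 h2) h3) h4
      _ = Nv ^ 4 := by ring
  · right; omega

/-! ### THE RUNG -/

/-- **RUNG XY-LM_FM (perturbative XY-Lieb–Mattis ordering near the ferromagnetic point), PROVED:**
`TotalSpinMonotoneNearFM` — on every torus `(ℤ/L)²` there is `η₀ > 0` such that for `1 − η₀ < Δ ≤ 1` and all Perron sector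
ground amplitudes `ψ_M, ψ_{M'}` of `H(Δ)`: `|M| ≤ |M'| ⇒ ⟨S⃗²⟩_{ψ_M} ≤ ⟨S⃗²⟩_{ψ_{M'}}`.
[conjecture: theory seat hubbard-h0-rotor-theory-1, cycle 11, memo ROTOR-THEORY-11 §154 — proved here] -/
theorem totalSpinMonotoneNearFM_holds : TotalSpinMonotoneNearFM := by
  intro L _
  classical
  -- torus data
  have hreg := torus_degree_const (L := L)
  set d : ℕ := (univ.filter fun z : TorusSite 2 L => (torusGraph 2 L).Adj 0 z).card with hd
  set Nv : ℕ := Fintype.card (TorusSite 2 L) with hNv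
  by_cases hV4 : 4 ≤ Nv
  · -- the bulk machinery exists
    have hNvL : Nv = L ^ 2 := by rw [hNv, Fintype.card_fun, ZMod.card, Fintype.card_fin]
    have hL2 : 2 ≤ L := by
      by_contra h; push Not at h
      have : L ^ 2 ≤ 1 := by nlinarith
      omega
    have hNv1 : ((Nv : ℝ) - 1) ≠ 0 := by
      have : (4:ℝ) ≤ Nv := by exact_mod_cast hV4
      linarith
    set κ : ℝ := (d : ℝ) / ((Nv : ℝ) - 1) with hκdef
    have hκ : κ * ((Fintype.card (TorusSite 2 L) : ℝ) - 1) = d := by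
      rw [← hNv, hκdef]; field_simp
    obtain ⟨v, hv, hAv, hlow⟩ :=
      exists_solved_twoMagnon (torusGraph 2 L) (torusGraph_connected_of_proj 2 L) d κ hreg hκ
    have hvv : 0 < v ⬝ᵥ v := solved_twoMagnon_ne_zero hL2 d κ hreg hκ v hAv
    -- envelope constants, sector by sector
    have henv : ∀ k : ℕ, ∃ C₄ C₅ : ℝ, 0 ≤ C₄ ∧ 0 ≤ C₅ ∧ (k + 2 ≤ Nv →
        ∀ η : ℝ, 0 ≤ η → η ≤ 1 → ∀ (M : ℝ) (a : TensorIndex (TorusSite 2 L) 2 → ℝ),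
          IsPerronSectorGroundAmplitude L (1 - η) M a →
          (((k + 2 : ℕ) : ℝ) = (Fintype.card (TorusSite 2 L) : ℝ) / 2 + M) →
          ∀ s : ℝ, 0 < s → s ≤ 1 →
            |secRes (k + 2) a ⬝ᵥ secOp (⊤ : SimpleGraph (TorusSite 2 L)) (k + 2) (secRes (k + 2) a)
                - η ^ 2 * (((Fintype.card (TorusSite 2 L) : ℝ) - 1) * pOne k v)|
              ≤ (s + C₄ * η ^ 2) * (η ^ 2 * (((Fintype.card (TorusSite 2 L) : ℝ) - 1) * pOne k v))
                + (1 + s⁻¹) * C₅ * η ^ 3) := by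
      intro k
      by_cases hk : k + 2 ≤ Nv
      · obtain ⟨C₄, C₅, h4, h5, h⟩ := perron_deficit_envelope d κ hreg k hk v hv hAv hlow
        exact ⟨C₄, C₅, h4, h5, fun _ => h⟩
      · exact ⟨0, 0, le_rfl, le_rfl, fun h => absurd h hk⟩
    choose C₄ C₅ hC₄ hC₅ henv' using henv
    -- uniform constants
    set SC₄ : ℝ := ∑ k ∈ Finset.range Nv, C₄ k with hSC₄
    set SC₅ : ℝ := ∑ k ∈ Finset.range Nv, C₅ k with hSC₅
    have hSC₄0 : 0 ≤ SC₄ := Finset.sum_nonneg fun k _ => hC₄ k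
    have hSC₅0 : 0 ≤ SC₅ := Finset.sum_nonneg fun k _ => hC₅ k
    have hC₄le : ∀ k, k < Nv → C₄ k ≤ SC₄ := fun k hk =>
      Finset.single_le_sum (f := C₄) (fun i _ => hC₄ i) (Finset.mem_range.2 hk)
    have hC₅le : ∀ k, k < Nv → C₅ k ≤ SC₅ := fun k hk =>
      Finset.single_le_sum (f := C₅) (fun i _ => hC₅ i) (Finset.mem_range.2 hk)
    set P₄ : ℝ := (Nv : ℝ) * ((Nv : ℝ) - 1) * ((Nv : ℝ) - 2) * ((Nv : ℝ) - 3) with hP₄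
    have hP₄0 : 0 < P₄ := by
      have h4 : (4:ℝ) ≤ Nv := by exact_mod_cast hV4
      exact mul_pos (mul_pos (mul_pos (by linarith) (by linarith)) (by linarith)) (by linarith)
    set lamP : ℝ := ((Nv : ℝ) - 1) * (v ⬝ᵥ v) / P₄ with hlamP
    have hlamP0 : 0 < lamP := by
      have h4 : (4:ℝ) ≤ Nv := by exact_mod_cast hV4
      exact div_pos (mul_pos (by linarith) hvv) hP₄0
    set G : ℝ := (Nv : ℝ) ^ 4 with hG
    have hNv4 : (4:ℝ) ≤ Nv := by exact_mod_cast hV4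
    have hG0 : 0 < G := pow_pos (by linarith) 4
    have hG1 : (1:ℝ) ≤ G := one_le_pow₀ (by linarith)
    set Den : ℝ := 2 * lamP * G * (2 * SC₄) + (1 + 4 * G) * (2 * SC₅) + 1 with hDen
    have h2lG : 0 ≤ 2 * lamP * G := mul_nonneg (mul_nonneg (by norm_num) hlamP0.le) hG0.le
    have h14G : 0 ≤ 1 + 4 * G := by linarith
    have hDen0 : 0 < Den := by
      have h1 : 0 ≤ 2 * lamP * G * (2 * SC₄) := mul_nonneg h2lG (by linarith)
      have h2 : 0 ≤ (1 + 4 * G) * (2 * SC₅) := mul_nonneg h14G (by linarith)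
      linarith
    set η₀ : ℝ := min 1 ((lamP / 2) / Den) with hη₀
    have hη₀0 : 0 < η₀ := lt_min one_pos (div_pos (by linarith) hDen0)
    refine ⟨η₀, hη₀0, ?_⟩
    intro Δ hΔ1 hΔ2 M M' a a' ha ha' hMM'
    apply totalSpinSq_le_of_inner_top_le ha ha'
    obtain ⟨n, hnle, hn⟩ := perron_natSector ha
    obtain ⟨n', hn'le, hn'⟩ := perron_natSector ha'
    by_cases hedge : n' ≤ 1 ∨ Nv - 1 ≤ n'
    · exact inner_top_le_of_edge ha' n' hn'le hn' hedge a
    · push Not at hedge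
      obtain ⟨h2n', hn'2⟩ := hedge
      -- the bulk: `2 ≤ n' ≤ Nv − 2`, hence `2 ≤ n ≤ Nv − 2`
      have hNvR : ((Nv : ℕ) : ℝ) = (Fintype.card (TorusSite 2 L) : ℝ) := by rw [hNv]
      have hM'abs : |M'| ≤ (Nv : ℝ) / 2 - 2 := by
        rw [abs_le]
        have h1 : (2:ℝ) ≤ n' := by exact_mod_cast h2n'
        have h2 : (n' : ℝ) + 2 ≤ Nv := by exact_mod_cast (by omega : n' + 2 ≤ Nv)
        constructor <;> linarith
      have hMabs : |M| ≤ (Nv : ℝ) / 2 - 2 := hMM'.trans hM'abs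
      have hn2 : 2 ≤ n ∧ n + 2 ≤ Nv := by
        have h := abs_le.1 hMabs
        have h1 : (2:ℝ) ≤ n := by linarith [h.1]
        have h2 : (n:ℝ) + 2 ≤ Nv := by linarith [h.2]
        exact ⟨by exact_mod_cast h1, by exact_mod_cast h2⟩
      rcases lt_or_eq_of_le hMM' with hlt | heq
      · -- |M| < |M'|: the second-order comparison
        set η : ℝ := 1 - Δ with hηdef
        have hη0 : 0 ≤ η := by rw [hηdef]; linarith
        have hηη₀ : η < η₀ := by rw [hηdef]; linarith
        have hη1 : η ≤ 1 := (hηη₀.le).trans (min_le_left _ _)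
        have hηsmall : η ≤ (lamP / 2) / Den := (hηη₀.le).trans (min_le_right _ _)
        have hΔη : Δ = 1 - η := by rw [hηdef]; ring
        rw [hΔη] at ha ha'
        obtain ⟨k, rfl⟩ : ∃ k, n = k + 2 := ⟨n - 2, by omega⟩
        obtain ⟨k', rfl⟩ : ∃ k', n' = k' + 2 := ⟨n' - 2, by omega⟩
        have hk : k + 2 ≤ Nv := by have := hn2.2; omega
        have hk' : k' + 2 ≤ Nv := by omega
        set s : ℝ := 1 / (4 * G) with hs
        have hs0 : 0 < s := div_pos one_pos (by linarith)
        have hs1 : s ≤ 1 := by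
          rw [hs, div_le_one (by linarith)]
          linarith
        have env := henv' k hk η hη0 hη1 M a ha hn s hs0 hs1
        have env' := henv' k' hk' η hη0 hη1 M' a' ha' hn' s hs0 hs1
        -- the deficits as full-space forms
        rw [dot_secOp, perron_secExt ha hn] at env
        rw [dot_secOp, perron_secExt ha' hn'] at env'
        -- the leading coefficients: `(|V|−1)·pOne = lamP·cg`
        have hV4' : 4 ≤ Fintype.card (TorusSite 2 L) := hV4
        have hpk := pOne_eq_cgShape k v hlow hk hV4'
        have hpk' := pOne_eq_cgShape k' v hlow hk' hV4'
        set cgN : ℕ := (k + 2) * (Nv - (k + 2)) * (k + 2 - 1) * (Nv - (k + 2) - 1) with hcgN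
        set cgN' : ℕ := (k' + 2) * (Nv - (k' + 2)) * (k' + 2 - 1) * (Nv - (k' + 2) - 1) with hcgN'
        have hcg : cgShape ((Fintype.card (TorusSite 2 L) : ℝ) / 2) (((k + 2 : ℕ) : ℝ)
            - (Fintype.card (TorusSite 2 L) : ℝ) / 2) = (cgN : ℝ) := by
          rw [← hNvR]; exact cgShape_natCast Nv (k + 2) (by omega) (by omega) _ (by ring)
        have hcg' : cgShape ((Fintype.card (TorusSite 2 L) : ℝ) / 2) (((k' + 2 : ℕ) : ℝ)
            - (Fintype.card (TorusSite 2 L) : ℝ) / 2) = (cgN' : ℝ) := by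
          rw [← hNvR]; exact cgShape_natCast Nv (k' + 2) (by omega) (by omega) _ (by ring)
        have hcgM : cgShape ((Nv : ℝ) / 2) M = (cgN : ℝ) := by
          rw [hNvR, ← hcg]; congr 1; rw [hn]; ring
        have hcgM' : cgShape ((Nv : ℝ) / 2) M' = (cgN' : ℝ) := by
          rw [hNvR, ← hcg']; congr 1; rw [hn']; ring
        have hlead : ((Fintype.card (TorusSite 2 L) : ℝ) - 1) * pOne k v = lamP * (cgN : ℝ) := by
          rw [hpk, hcg, hlamP, hP₄, hNvR]; ring
        have hlead' : ((Fintype.card (TorusSite 2 L) : ℝ) - 1) * pOne k' v = lamP * (cgN' : ℝ) := by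
          rw [hpk', hcg', hlamP, hP₄, hNvR]; ring
        rw [hlead] at env
        rw [hlead'] at env'
        -- the gap `cg' + 1 ≤ cg` (strict CG monotonicity + integrality) and the crude bound `cg ≤ |V|⁴`
        have hlt' : cgShape ((Nv : ℝ) / 2) M' < cgShape ((Nv : ℝ) / 2) M :=
          cgShape_strictAnti _ M M' (abs_nonneg M) hlt (by linarith [hM'abs])
        rw [hcgM, hcgM'] at hlt'
        have hgapN : cgN' + 1 ≤ cgN := by exact_mod_cast hlt'
        have hgap : (cgN' : ℝ) + 1 ≤ (cgN : ℝ) := by exact_mod_cast hgapN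
        have hGb : (cgN : ℝ) + (cgN' : ℝ) ≤ 2 * G := by
          have h1 : cgN ≤ Nv ^ 4 := by
            rcases cgNat_le Nv (k + 2) with h | h
            · exact h
            · omega
          have h2 : cgN' ≤ Nv ^ 4 := by
            rcases cgNat_le Nv (k' + 2) with h | h
            · exact h
            · omega
          have h1' : (cgN : ℝ) ≤ G := by rw [hG]; exact_mod_cast h1
          have h2' : (cgN' : ℝ) ≤ G := by rw [hG]; exact_mod_cast h2
          linarith
        -- smallness of η against this pair's constants
        have hkN : k < Nv := by omega
        have hk'N : k' < Nv := by omega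
        have hcoef : 2 * lamP * G * (C₄ k + C₄ k') + (1 + 4 * G) * (C₅ k + C₅ k') ≤ Den := by
          have h1 : C₄ k + C₄ k' ≤ 2 * SC₄ := by linarith [hC₄le k hkN, hC₄le k' hk'N]
          have h2 : C₅ k + C₅ k' ≤ 2 * SC₅ := by linarith [hC₅le k hkN, hC₅le k' hk'N]
          have h3 : 2 * lamP * G * (C₄ k + C₄ k') ≤ 2 * lamP * G * (2 * SC₄) :=
            mul_le_mul_of_nonneg_left h1 h2lG
          have h4 : (1 + 4 * G) * (C₅ k + C₅ k') ≤ (1 + 4 * G) * (2 * SC₅) :=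
            mul_le_mul_of_nonneg_left h2 h14G
          linarith
        have hsmall : η * (2 * lamP * G * (C₄ k + C₄ k') + (1 + 4 * G) * (C₅ k + C₅ k')) ≤ lamP / 2 := by
          calc η * (2 * lamP * G * (C₄ k + C₄ k') + (1 + 4 * G) * (C₅ k + C₅ k'))
              ≤ η * Den := mul_le_mul_of_nonneg_left hcoef hη0
            _ ≤ (lamP / 2) / Den * Den := mul_le_mul_of_nonneg_right hηsmall hDen0.le
            _ = lamP / 2 := by field_simp
        exact pair_ineq η lamP (cgN : ℝ) (cgN' : ℝ) (C₄ k) (C₄ k') (C₅ k) (C₅ k') G _ _ hη0 hη1 hlamP0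
          (Nat.cast_nonneg _) hgap hGb hG0 (hC₄ k) (hC₄ k') env env' hsmall
      · -- |M| = |M'|: uniqueness or particle–hole conjugation
        rcases abs_eq_abs.1 heq.symm with h | h
        · subst h; rw [perron_eq ha ha']
        · subst h
          rw [perron_neg_eq_flip ha ha', inner_fmOp_flipAll]
  · -- tiny tori (`|V| < 4`): every sector is extreme
    refine ⟨1, one_pos, ?_⟩
    intro Δ hΔ1 hΔ2 M M' a a' ha ha' hMM'
    apply totalSpinSq_le_of_inner_top_le ha ha'
    obtain ⟨n', hn'le, hn'⟩ := perron_natSector ha'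
    exact inner_top_le_of_edge ha' n' hn'le hn' (by omega) a

end Torus

end Summit.HubbardSuperconductivity.HubbardSuperconductivity.Theorems.AnisotropyChord.Tower
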